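import Mathlib
import HarnessLib
import Literature.Analysis.FluidPDE.AncientSimilarityVariables
import Literature.Analysis.FluidPDE.SpaceTimeCalculusC1
import Summits.NavierStokesRegularity.NavierStokesRegularity.Theorems.QuarterLogPincerFlatWindowDefs

/-!
# Crux `QuarterLogPincer.TypeIQuantSubcubicExp` (stmt-NavierStokesRegularity-24077), rung line `flat_window`:
  STUB (S) `stub_sliceDictionary` — PROVED

Lead-prover file (ns-tc-p1 g4; DIRECTOR-NS #210 (1); `--supports stmt-NavierStokesRegularity-24077
--as helper`) proving BY NAME, with its verbatim signature `stub_sliceDictionary : SliceDictionary`, the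
size-S obligation of ns-idea-7's rung line `Cruxes/TypeIQuantSubcubicExp/Lines/flat_window.lean`
(183c0c8f2f447a08, idea-crit-7 PASS-WITH-PRICE) over the re-homed definitions module
`Theorems/QuarterLogPincerFlatWindowDefs.lean` (`pvRegion`, `pvSliceDefect`, `profileLine`,
`SliceDictionary` verbatim).

* `hasDerivAt_profileLine_of_contDiffOn` — the chain rule for any field jointly `C¹` on the open
  past: `s ↦ U(s, x/√(−t))`, `U = lerayOrbit u`, has derivative
  `√(−t) • ((−t) D(uncurry u)(t,x)(1,0) − ½ u(t,x) − ½ Du(t,x)[x])` at `s = −log(−t)` (the tree's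
  `hasDerivAt_lerayOrbit` at the similarity point `Φ(−log(−t), x/√(−t)) = (t,x)`,
  `ancientSimMap_ancientSimInv`).
* `stub_sliceDictionary` — the registered statement: at interior times `t ∈ (−1,0)` and `‖x‖ < 1`
  the time derivative within `pvRegion` is the genuine partial derivative
  (`timeDerivOn_of_mem_nhds`, `hasDerivAt_timeLine_of_contDiffOn`), and the chain rule concludes.

HONEST FRAMING: a bookkeeping stub of a RUNG line on the DSS wall; the line does not conclude the
crux; the crux `TypeIQuantSubcubicExp`, its parent `SuperlogCubeRate` and Navier–Stokes regularity
remain OPEN; no summit statement is proved by this file.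
-/

noncomputable section

-- the summit-side namespace `Summit.NavierStokesRegularity.NavierStokesRegularity.…` (single-conjunct summit,
-- D-0017) repeats a component by design; the dupNamespace linter would flag every declaration.
set_option linter.dupNamespace false

namespace Summit.NavierStokesRegularity.NavierStokesRegularity.Cruxes.TypeIQuantSubcubicExp.FlatWindow

open MeasureTheory Set Function Filter Topology Metric
open Literature.Analysis Literature.Analysis.FluidPDE

/-- The chain rule behind the dictionary, for any field jointly `C¹` on the open past: at `t < 0`
and any `x`, the profile line through the label `y = x/√(−t)` has derivative
`√(−t) • ((−t) ∂ₜu(t,x) − ½ u(t,x) − ½ Du(t,x)[x])` at `s = −log(−t)`, where `∂ₜu(t,x) = D(uncurry u)(t,x)(1,0)`.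
[folklore] -/
theorem hasDerivAt_profileLine_of_contDiffOn
    {u : ℝ → EuclideanSpace ℝ (Fin 3) → EuclideanSpace ℝ (Fin 3)}
    (hw : ContDiffOn ℝ 1 (uncurry u) (Iio 0 ×ˢ univ)) {t : ℝ} (ht0 : t < 0)
    (x : EuclideanSpace ℝ (Fin 3)) :
    HasDerivAt (profileLine u ((Real.sqrt (-t))⁻¹ • x))
      (Real.sqrt (-t) • ((-t) • fderiv ℝ (uncurry u) (t, x) (1, 0) - (1 / 2 : ℝ) • u t x
        - (1 / 2 : ℝ) • fderiv ℝ (u t) x x)) (-Real.log (-t)) := by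
  have hnh : Iio (0 : ℝ) ∈ 𝓝 t := Iio_mem_nhds ht0
  set L := fderiv ℝ (uncurry u) (t, x) with hL
  have hLu : HasFDerivAt (uncurry u) L (t, x) := hasFDerivAt_uncurry_of_contDiffOn hw hnh x
  have hsl : fderiv ℝ (u t) x = L.comp (ContinuousLinearMap.inr ℝ ℝ (EuclideanSpace ℝ (Fin 3))) :=
    (hasFDerivAt_slice_of_contDiffOn hw hnh x).fderiv
  have hpos : 0 < -t := neg_pos.2 ht0
  have hsq : 0 < Real.sqrt (-t) := Real.sqrt_pos.2 hpos
  have hpt : ancientSimMap ((-Real.log (-t), (Real.sqrt (-t))⁻¹ • x) : ℝ × EuclideanSpace ℝ (Fin 3))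
      = (t, x) :=
    ancientSimMap_ancientSimInv (z := ((t, x) : ℝ × EuclideanSpace ℝ (Fin 3))) ht0
  have hLs : HasFDerivAt (uncurry u) L
      (ancientSimMap ((-Real.log (-t), (Real.sqrt (-t))⁻¹ • x) : ℝ × EuclideanSpace ℝ (Fin 3))) := by
    rw [hpt]; exact hLu
  have hD := hasDerivAt_lerayOrbit hLs
  have he1 : Real.exp (-(-Real.log (-t))) = -t := by rw [neg_neg, Real.exp_log hpos]
  have he2 : Real.exp (-(-Real.log (-t)) / 2) = Real.sqrt (-t) := by
    rw [neg_neg, eq_comm, Real.sqrt_eq_iff_eq_sq hpos.le (Real.exp_pos _).le, sq, ← Real.exp_add,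
      add_halves, Real.exp_log hpos]
  rw [he1, he2, smul_smul, mul_inv_cancel₀ hsq.ne', one_smul] at hD
  have hprof : profileLine u ((Real.sqrt (-t))⁻¹ • x) = fun r => lerayOrbit u r ((Real.sqrt (-t))⁻¹ • x) := rfl
  rw [hprof]
  refine hD.congr_deriv ?_
  -- the vector identity
  have hLy : L (0, (Real.sqrt (-t))⁻¹ • x) = (Real.sqrt (-t))⁻¹ • L (0, x) := by
    rw [← map_smul]; congr 1; simp
  have hsl' : fderiv ℝ (u t) x x = L (0, x) := by
    rw [hsl]; simp
  rw [hLy, hsl', neg_neg, smul_smul (1 / 2 * Real.sqrt (-t) ^ 2)]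
  have k : (1 / 2 : ℝ) * Real.sqrt (-t) ^ 2 * (Real.sqrt (-t))⁻¹ = 1 / 2 * Real.sqrt (-t) := by
    rw [sq, mul_assoc, mul_assoc, mul_inv_cancel₀ hsq.ne', mul_one]
  rw [k]
  module

/-- **STUB (S) `stub_sliceDictionary` of LINE `flat_window` — PROVED (signature verbatim).**  The
slice dictionary (Chae–Wolf 2017 §4 / Pineau–Vicol 2026 (1.17) vs (1.12)): for a classical solution on
`(−∞,0) × ℝ³`, the one-slice defect `√(−t)((−t)∂ₜu − ½u − ½Du[x])` at `(t,x)`, `−1 < t < 0`,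
`‖x‖ < 1` (time derivative within `pvRegion = [−1,0) × B₁`, which at an interior time is the genuine
one, `timeDerivOn_of_mem_nhds`), IS the profile velocity `∂ₛU(s,y)` at `s = −log(−t)`,
`y = x/√(−t)` — the tree's chain rule `hasDerivAt_lerayOrbit` read at the similarity point.
[folklore] -/
theorem stub_sliceDictionary : SliceDictionary := by
  intro u p hcl t ht1 ht0 x hx
  have hw : ContDiffOn ℝ 1 (uncurry u) (Iio 0 ×ˢ univ) :=
    hcl.smooth_velocity.of_le (by exact_mod_cast le_top)
  have hnh : Iio (0 : ℝ) ∈ 𝓝 t := Iio_mem_nhds ht0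
  -- the time derivative within `pvRegion` at an interior time is the genuine one
  have hsec : timeSection pvRegion x = Ico (-1 : ℝ) 0 := timeSection_prod _ hx
  have htd : timeDerivOn pvRegion u t x = fderiv ℝ (uncurry u) (t, x) (1, 0) := by
    rw [timeDerivOn_of_mem_nhds u (by rw [hsec]; exact Ico_mem_nhds ht1 ht0)]
    exact (hasDerivAt_timeLine_of_contDiffOn hw hnh x).deriv
  rw [(hasDerivAt_profileLine_of_contDiffOn hw ht0 x).deriv, pvSliceDefect, htd]

end Summit.NavierStokesRegularity.NavierStokesRegularity.Cruxes.TypeIQuantSubcubicExp.FlatWindow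

end
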